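import Literature.AlgebraicGeometry.Motives.HodgeStructureEndActionCommutantFactorMatrixAlgebras
import Literature.AlgebraicGeometry.Motives.HodgeStructureCentralizerBlockwiseCharpoly
import HarnessLib

/-!
# «`V(A) = V₁ ⊕ ⋯ ⊕ V_t`, `Vᵢ = eᵢV`» IS AN INTERNAL DIRECT SUM OF `K ⊗ V` FOR EVERY FIELD `K ⊇ ℚ`, «`α = α₁ ⊕ ⋯ ⊕ α_t`» FOR EVERY
# `α ∈ C_K(F)` WITH `P(α) = ∏ᵢ P(αᵢ)`, AND ON EACH BLOCK «`P_{A,α} = ∏ P_{Lᵢ/k,α}^{mᵢ}`» TERM BY TERM: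
# `P(ι_K(u)|Vᵢ) = P_{Fᵢ/K}(ū)^d`, `tr(ι_K(u)|Vᵢ) = d · Tr_{Fᵢ/K}(ū)` (Milne 1999 §2 p. 646 L43–L50, Prop. 2.1 p. 647)

[topic AlgebraicGeometry/Motives]

Layer `Literature/AlgebraicGeometry/Motives`, lane `lit-hodgefound` (Track 2 foundations library; prover seat
`lit-hodgefound-p02`, generation 57, self-proposed row g57-#6; sequel of g57-#1 `Motives/HodgeStructureEndActionCharpolyFactorFields`
(whose docstring lists as NOT done «the restriction of `ι_K(u)` to the block `V_𝔪 = e_𝔪(K ⊗ V)` … its characteristic polynomial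
`P(ū· | F_𝔪)^d`»), g57-#4 `Motives/HodgeStructureCentralizerBlockwiseCharpoly` (the generic `P(f) = ∏ᵢ P(f|Nᵢ)` on an internal
direct sum) and g57-#5 `Motives/HodgeStructureEndActionCommutantFactorMatrixAlgebras` (`ι_K(u) ∈ C_K(F)`)). THEOREMS ONLY: no
definition, no named fact (net debt `0`), no instance, no notation.

Milne §2 p. 646: «`V(A) = V₁ ⊕ ⋯ ⊕ V_t`, `Vᵢ = eᵢV` … Any `k`-linear map `α : V → V` commuting with the action of `F` decomposes into
`α = α₁ ⊕ ⋯ ⊕ α_t`, `αᵢ : Vᵢ → Vᵢ`, `Fᵢ`-linear», and in the proof of Prop. 2.1 (p. 647) «from the isomorphism of `L ⊗_ℚ k`-modules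
`V(A) ≈ ⊕ Lᵢ^{mᵢ}` we find that `P_{A,α}(X) = ∏ P_{Lᵢ/k,α}(X)^{mᵢ}`» — the `i`-th factor being the characteristic polynomial of `α`
on the block `Vᵢ ≈ Lᵢ^{mᵢ}`.  On the tree's carrier (`A : EndAction H F`, ANY field `K ⊇ ℚ`, `ι_K = baseChangeAction K A.ι`,
`C_K(F)` the commutant of `range ι_K`, `d = dim_ℚ V/[F:ℚ]`, primitive idempotents `e_𝔪` of `K ⊗_ℚ F`, `F_𝔪 = (K ⊗ F)/𝔪`, blocks
`V_𝔪 = ι_K(e_𝔪)(K ⊗ V)` of `K`-dimension `d·[F_𝔪 : K]`, g56-#13), all PROVED: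
(i) the `ι_K(e_𝔪)` form a complete orthogonal family of idempotent endomorphisms, so **`K ⊗ V = ⊕_𝔪 V_𝔪` is INTERNAL**
(g56-#13 had only the dimension count `Σ_𝔪 dim V_𝔪 = dim_ℚ V`);
(ii) every `α ∈ C_K(F)` preserves each `V_𝔪` (g56-#14) and **`P(α) = ∏_𝔪 P(α|V_𝔪)`, `det α = ∏_𝔪 det(α|V_𝔪)`, `tr α = Σ_𝔪 tr(α|V_𝔪)`**;
(iii) `ι_K(u)` and `ι_K(u e_𝔪)` agree on `V_𝔪`, and `ι_K(u e_𝔪)` kills the other blocks (`e_𝔪 e_𝔫 = 0`);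
(iv) **`P(ι_K(u)|V_𝔪) = P(ū_𝔪· | F_𝔪)^d`** and **`tr(ι_K(u)|V_𝔪) = d · Tr_{F_𝔪/K}(ū_𝔪)`** for every `u ∈ K ⊗_ℚ F` — «`P_{A,α} = ∏ᵢ
P_{Lᵢ/k,α}^{mᵢ}`» block by block with `mᵢ = d`: apply (ii) and g57-#1's `P(ι_K(u')) = ∏_𝔫 P(ū'_𝔫 | F_𝔫)^d` to `u' = u e_𝔪`, whose
other blocks and other residues vanish, and cancel the common monic factor `∏_{𝔫 ≠ 𝔪} X^{d·[F_𝔫:K]}` in `K[X]`.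

## The source, verbatim

J. S. Milne, *Lefschetz classes on abelian varieties*, Duke Math. J. **96** (1999) 639–675 [Milne1999LefschetzClasses] (held
`paper:doi-10-1215-s0012-7094-99-09620-5`; Duke page = folio + 638), p. 646 (p0008) L43–L50: «Let `F ⊗_ℚ k = F₁ × ⋯ × F_t`, be
the decomposition of `F ⊗_ℚ k` into a product of fields, and let `1 = e₁ + ⋯ + e_t`, be the corresponding decomposition of `1`
into a sum of orthogonal idempotents. Then `V(A) = V₁ ⊕ ⋯ ⊕ V_t`, `Vᵢ = eᵢV = V ⊗_{F ⊗_ℚ k} Fᵢ`. Proposition 2.1 below shows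
that `Vᵢ` has dimension `2g/f` over `Fᵢ`. Any `k`-linear map `α : V → V` commuting with the action of `F` decomposes into
`α = α₁ ⊕ ⋯ ⊕ α_t`, `αᵢ : Vᵢ → Vᵢ`, `Fᵢ`-linear.»; p. 647 (p0009) L27–L36: «From the decomposition `L ⊗_ℚ k = ∏ Lᵢ` we find
that `P_{L/ℚ,α}(X) = ∏ᵢ P_{Lᵢ/k,α}(X)` … From the isomorphism of `L ⊗_ℚ k`-modules `V(A) ≈ ⊕ Lᵢ^{mᵢ}` we find that
`P_{A,α}(X) = ∏ P_{Lᵢ/k,α}(X)^{mᵢ}`. … each `mᵢ = m`.»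

## What is PROVED (namespace `Literature.AlgebraicGeometry.Motives.HodgeStructure.EndAction`)

* **`completeOrthogonalIdempotents_baseChangeAction`**, **`isInternal_range_baseChangeAction`** (`K ⊗ V = ⊕_𝔪 ι_K(e_𝔪)(K ⊗ V)`).
* **`apply_mem_range_baseChangeAction_of_mem_centralizer`**; **`charpoly_eq_prod_charpoly_restrict_of_mem_centralizer`**,
  **`det_eq_prod_det_restrict_of_mem_centralizer`**, **`trace_eq_sum_trace_restrict_of_mem_centralizer`** (every `α ∈ C_K(F)`).
* `baseChangeAction_mul_apply_of_mem_range` (`ι_K(u e_𝔪) = ι_K(u)` on `V_𝔪`), `baseChangeAction_mul_apply_eq_zero_of_mem_range`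
  (`ι_K(u e_𝔪) = 0` on `V_𝔫`, `𝔫 ≠ 𝔪`), `restrict_baseChangeAction_mul_primitive_eq`, `restrict_baseChangeAction_mul_primitive_eq_zero`.
* **`charpoly_restrict_baseChangeAction_eq_pow`** (`P(ι_K(u)|V_𝔪) = P(ū_𝔪·|F_𝔪)^d`), **`trace_restrict_baseChangeAction_eq`**
  (`tr(ι_K(u)|V_𝔪) = d · Tr_{F_𝔪/K}(ū_𝔪)`).
* (appended, g57-#8) **`det_restrict_baseChangeAction_eq_pow`** (`det(ι_K(u)|V_𝔪) = N_{F_𝔪/K}(ū_𝔪)^d`, from the characteristic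
  polynomial's constant term), **`isUnit_restrict_baseChangeAction_iff`** (`V ≠ 0`: `ι_K(u)|V_𝔪` invertible `⟺ u ∉ 𝔪`, i.e.
  `ū_𝔪 ≠ 0`), **`det_restrict_baseChangeAction_ne_zero_iff`**.

NOT here: the `F_𝔪`-vector space structure of `V_𝔪`.

Nearest tree results, BY NAME: g56-#13 `finrank_range_baseChangeAction_eq_of_notMem` (`dim_K V_𝔪 = d·[F_𝔪:K]`), `sum_finrank_range_baseChangeAction_eq`,
`existsUnique_isIdempotentElem_baseChange_notMem`; g56-#14 `map_range_baseChangeAction_le_of_mem_centralizer`; g57-#1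
`charpoly_baseChangeAction_eq_prod_pow`, `trace_baseChangeAction_eq_mul_sum`, `mk_eq_one_of_isIdempotentElem_of_notMem`; g57-#4
`charpoly_eq_prod_charpoly_restrict_of_isInternal`, `det_eq_prod_det_restrict_of_isInternal`, `charpoly_smul_one_eq_pow`, `trace_smul_one_eq`;
g57-#5 `baseChangeAction_mem_centralizer_range`; `HodgeStructure.completeOrthogonalIdempotents_primitiveIdempotents`;
`Literature.Algebra.Module.KrullSchmidt.isInternal_range_of_completeOrthogonalIdempotents`; Mathlib `LinearMap.trace_eq_sum_trace_restrict`.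

## References

* [Milne1999LefschetzClasses] J. S. Milne, *Lefschetz classes on abelian varieties*, Duke Math. J. 96 (1999) 639–675, §2
  p. 646 L43–L50 and Prop. 2.1 with its proof (p. 647 L14–L36).
-/

noncomputable section

open scoped TensorProduct
open Polynomial

namespace Literature.AlgebraicGeometry.Motives

namespace HodgeStructure

namespace EndAction

universe v uK

variable {V : Type v} [AddCommGroup V] [Module ℚ V] {n : ℤ} {H : HodgeStructure V n}
variable {F : Type*} [Field F] [NumberField F]
variable (K : Type uK) [Field K] [Algebra ℚ K] (A : EndAction H F)

/-! ## §1 «`V(A) = V₁ ⊕ ⋯ ⊕ V_t`» is internal -/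

/-- **THE BLOCK IDEMPOTENTS `ι_K(e_𝔪)` FORM A COMPLETE ORTHOGONAL FAMILY** of idempotent endomorphisms of `K ⊗ V` (image under the
algebra homomorphism `ι_K` of «`1 = e₁ + ⋯ + e_t` … orthogonal idempotents» in `K ⊗_ℚ F`). [cite: Milne1999LefschetzClasses, §2 p. 646 L43–L47] -/
theorem completeOrthogonalIdempotents_baseChangeAction [Fintype (MaximalSpectrum (K ⊗[ℚ] F))]
    {e : MaximalSpectrum (K ⊗[ℚ] F) → K ⊗[ℚ] F}
    (he : ∀ I, IsIdempotentElem (e I) ∧ e I ∉ I.asIdeal ∧ ∀ J : MaximalSpectrum (K ⊗[ℚ] F), J ≠ I → e I ∈ J.asIdeal) :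
    CompleteOrthogonalIdempotents fun I => baseChangeAction K A.ι (e I) := by
  haveI := isReduced_baseChange_numberField K F
  exact (completeOrthogonalIdempotents_primitiveIdempotents K he).map (baseChangeAction K A.ι).toRingHom

set_option maxSynthPendingDepth 4 in
/-- **«`V(A) = V₁ ⊕ ⋯ ⊕ V_t`, `Vᵢ = eᵢV`» FOR EVERY FIELD `K ⊇ ℚ`: `K ⊗ V = ⊕_𝔪 ι_K(e_𝔪)(K ⊗ V)` IS AN INTERNAL DIRECT SUM** over the
maximal ideals `𝔪` of `K ⊗_ℚ F` (g56-#13 counted it: `Σ_𝔪 dim V_𝔪 = dim_ℚ V`). [cite: Milne1999LefschetzClasses, §2 p. 646 L43–L47] -/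
theorem isInternal_range_baseChangeAction [Fintype (MaximalSpectrum (K ⊗[ℚ] F))] [DecidableEq (MaximalSpectrum (K ⊗[ℚ] F))]
    {e : MaximalSpectrum (K ⊗[ℚ] F) → K ⊗[ℚ] F}
    (he : ∀ I, IsIdempotentElem (e I) ∧ e I ∉ I.asIdeal ∧ ∀ J : MaximalSpectrum (K ⊗[ℚ] F), J ≠ I → e I ∈ J.asIdeal) :
    DirectSum.IsInternal fun I => LinearMap.range (baseChangeAction K A.ι (e I)) :=
  Literature.Algebra.Module.KrullSchmidt.isInternal_range_of_completeOrthogonalIdempotents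
    (A.completeOrthogonalIdempotents_baseChangeAction K he)

/-! ## §2 «`α = α₁ ⊕ ⋯ ⊕ α_t`»: blockwise characteristic polynomial, determinant, trace for `α ∈ C_K(F)` -/

set_option maxSynthPendingDepth 4 in
/-- **«`αᵢ : Vᵢ → Vᵢ`»**: an `α` commuting with the action of `F` maps every block `ι_K(u)(K ⊗ V)` into itself (g56-#14
`map_range_baseChangeAction_le_of_mem_centralizer`, pointwise). [cite: Milne1999LefschetzClasses, §2 p. 646 L48–L50] -/
theorem apply_mem_range_baseChangeAction_of_mem_centralizer {γ : Module.End K (K ⊗[ℚ] V)}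
    (hγ : γ ∈ Subalgebra.centralizer K (Set.range (baseChangeAction K A.ι))) (u : K ⊗[ℚ] F) :
    ∀ x ∈ LinearMap.range (baseChangeAction K A.ι u), γ x ∈ LinearMap.range (baseChangeAction K A.ι u) :=
  fun _ hx => (A.map_range_baseChangeAction_le_of_mem_centralizer K hγ u).1 ⟨_, hx, rfl⟩

variable [Module.Finite ℚ V]

set_option maxSynthPendingDepth 4 in
/-- **«`α = α₁ ⊕ ⋯ ⊕ α_t`»: `P(α) = ∏_𝔪 P(α|V_𝔪)` FOR EVERY `α ∈ C_K(F)`** on `K ⊗ V = ⊕_𝔪 ι_K(e_𝔪)(K ⊗ V)`, every field `K ⊇ ℚ`.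
[cite: Milne1999LefschetzClasses, §2 p. 646 L43–L50] -/
theorem charpoly_eq_prod_charpoly_restrict_of_mem_centralizer [Fintype (MaximalSpectrum (K ⊗[ℚ] F))]
    [DecidableEq (MaximalSpectrum (K ⊗[ℚ] F))] {e : MaximalSpectrum (K ⊗[ℚ] F) → K ⊗[ℚ] F}
    (he : ∀ I, IsIdempotentElem (e I) ∧ e I ∉ I.asIdeal ∧ ∀ J : MaximalSpectrum (K ⊗[ℚ] F), J ≠ I → e I ∈ J.asIdeal)
    {γ : Module.End K (K ⊗[ℚ] V)} (hγ : γ ∈ Subalgebra.centralizer K (Set.range (baseChangeAction K A.ι))) :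
    γ.charpoly = ∏ I, (γ.restrict (A.apply_mem_range_baseChangeAction_of_mem_centralizer K hγ (e I))).charpoly :=
  charpoly_eq_prod_charpoly_restrict_of_isInternal K (A.isInternal_range_baseChangeAction K he) fun I =>
    A.apply_mem_range_baseChangeAction_of_mem_centralizer K hγ (e I)

set_option maxSynthPendingDepth 4 in
/-- **`det α = ∏_𝔪 det(α|V_𝔪)` for every `α ∈ C_K(F)`.** [cite: Milne1999LefschetzClasses, §2 p. 646 L43–L50] -/
theorem det_eq_prod_det_restrict_of_mem_centralizer [Fintype (MaximalSpectrum (K ⊗[ℚ] F))]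
    [DecidableEq (MaximalSpectrum (K ⊗[ℚ] F))] {e : MaximalSpectrum (K ⊗[ℚ] F) → K ⊗[ℚ] F}
    (he : ∀ I, IsIdempotentElem (e I) ∧ e I ∉ I.asIdeal ∧ ∀ J : MaximalSpectrum (K ⊗[ℚ] F), J ≠ I → e I ∈ J.asIdeal)
    {γ : Module.End K (K ⊗[ℚ] V)} (hγ : γ ∈ Subalgebra.centralizer K (Set.range (baseChangeAction K A.ι))) :
    LinearMap.det γ = ∏ I, LinearMap.det (γ.restrict (A.apply_mem_range_baseChangeAction_of_mem_centralizer K hγ (e I))) :=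
  det_eq_prod_det_restrict_of_isInternal K (A.isInternal_range_baseChangeAction K he) fun I =>
    A.apply_mem_range_baseChangeAction_of_mem_centralizer K hγ (e I)

set_option maxSynthPendingDepth 4 in
/-- **`tr α = Σ_𝔪 tr(α|V_𝔪)` for every `α ∈ C_K(F)`** (Mathlib `LinearMap.trace_eq_sum_trace_restrict` on the blocks).
[cite: Milne1999LefschetzClasses, §2 p. 646 L43–L50] -/
theorem trace_eq_sum_trace_restrict_of_mem_centralizer [Fintype (MaximalSpectrum (K ⊗[ℚ] F))]
    [DecidableEq (MaximalSpectrum (K ⊗[ℚ] F))] {e : MaximalSpectrum (K ⊗[ℚ] F) → K ⊗[ℚ] F}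
    (he : ∀ I, IsIdempotentElem (e I) ∧ e I ∉ I.asIdeal ∧ ∀ J : MaximalSpectrum (K ⊗[ℚ] F), J ≠ I → e I ∈ J.asIdeal)
    {γ : Module.End K (K ⊗[ℚ] V)} (hγ : γ ∈ Subalgebra.centralizer K (Set.range (baseChangeAction K A.ι))) :
    LinearMap.trace K (K ⊗[ℚ] V) γ =
      ∑ I, LinearMap.trace K _ (γ.restrict (A.apply_mem_range_baseChangeAction_of_mem_centralizer K hγ (e I))) :=
  LinearMap.trace_eq_sum_trace_restrict (A.isInternal_range_baseChangeAction K he) fun I =>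
    A.apply_mem_range_baseChangeAction_of_mem_centralizer K hγ (e I)

/-! ## §3 `ι_K(u e_𝔪)`: equal to `ι_K(u)` on `V_𝔪`, zero on the other blocks -/

omit [Module.Finite ℚ V] in
/-- **`ι_K(u e) = ι_K(u)` ON THE BLOCK `ι_K(e)(K ⊗ V)`** for an idempotent `e` (`u e e = u e`). [cite: Milne1999LefschetzClasses, §2 p. 646 L43–L50] -/
theorem baseChangeAction_mul_apply_of_mem_range {e : K ⊗[ℚ] F} (he : IsIdempotentElem e) (u : K ⊗[ℚ] F)
    {v : K ⊗[ℚ] V} (hv : v ∈ LinearMap.range (baseChangeAction K A.ι e)) :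
    baseChangeAction K A.ι (u * e) v = baseChangeAction K A.ι u v := by
  obtain ⟨w, rfl⟩ := hv
  rw [← Module.End.mul_apply, ← map_mul, mul_assoc, he.eq, map_mul, Module.End.mul_apply]

omit [Module.Finite ℚ V] in
/-- **`ι_K(u e) = 0` ON A BLOCK `ι_K(e')(K ⊗ V)` WITH `e e' = 0`** (the other blocks, «orthogonal idempotents»).
[cite: Milne1999LefschetzClasses, §2 p. 646 L43–L50] -/
theorem baseChangeAction_mul_apply_eq_zero_of_mem_range {e e' : K ⊗[ℚ] F} (hee' : e * e' = 0) (u : K ⊗[ℚ] F)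
    {v : K ⊗[ℚ] V} (hv : v ∈ LinearMap.range (baseChangeAction K A.ι e')) :
    baseChangeAction K A.ι (u * e) v = 0 := by
  obtain ⟨w, rfl⟩ := hv
  rw [← Module.End.mul_apply, ← map_mul, mul_assoc, hee', mul_zero, map_zero, LinearMap.zero_apply]

set_option maxSynthPendingDepth 4 in
omit [Module.Finite ℚ V] in
/-- The restrictions to the block `ι_K(e)(K ⊗ V)` of `ι_K(u e)` and of `ι_K(u)` coincide. [cite: Milne1999LefschetzClasses, §2 p. 646 L43–L50] -/
theorem restrict_baseChangeAction_mul_primitive_eq {e : K ⊗[ℚ] F} (he : IsIdempotentElem e) (u : K ⊗[ℚ] F)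
    (h₁ : ∀ x ∈ LinearMap.range (baseChangeAction K A.ι e), baseChangeAction K A.ι (u * e) x ∈ LinearMap.range (baseChangeAction K A.ι e))
    (h₂ : ∀ x ∈ LinearMap.range (baseChangeAction K A.ι e), baseChangeAction K A.ι u x ∈ LinearMap.range (baseChangeAction K A.ι e)) :
    (baseChangeAction K A.ι (u * e)).restrict h₁ = (baseChangeAction K A.ι u).restrict h₂ :=
  LinearMap.ext fun x => Subtype.ext (by
    rw [LinearMap.coe_restrict_apply, LinearMap.coe_restrict_apply]
    exact A.baseChangeAction_mul_apply_of_mem_range K he u x.2)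

set_option maxSynthPendingDepth 4 in
omit [Module.Finite ℚ V] in
/-- The restriction of `ι_K(u e)` to a block `ι_K(e')(K ⊗ V)` with `e e' = 0` vanishes. [cite: Milne1999LefschetzClasses, §2 p. 646 L43–L50] -/
theorem restrict_baseChangeAction_mul_primitive_eq_zero {e e' : K ⊗[ℚ] F} (hee' : e * e' = 0) (u : K ⊗[ℚ] F)
    (h₁ : ∀ x ∈ LinearMap.range (baseChangeAction K A.ι e'),
      baseChangeAction K A.ι (u * e) x ∈ LinearMap.range (baseChangeAction K A.ι e')) :
    (baseChangeAction K A.ι (u * e)).restrict h₁ = 0 :=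
  LinearMap.ext fun x => Subtype.ext (by
    rw [LinearMap.coe_restrict_apply, LinearMap.zero_apply, Submodule.coe_zero]
    exact A.baseChangeAction_mul_apply_eq_zero_of_mem_range K hee' u x.2)

/-! ## §4 «`P_{A,α}(X) = ∏ P_{Lᵢ/k,α}(X)^{mᵢ}`» BLOCK BY BLOCK: `P(ι_K(u)|V_𝔪) = P(ū_𝔪·|F_𝔪)^d` -/

set_option maxHeartbeats 400000 in
set_option maxSynthPendingDepth 4 in
/-- **«`P_{A,α}(X) = ∏ᵢ P_{Lᵢ/k,α}(X)^{mᵢ}`» TERM BY TERM, EVERY FIELD `K ⊇ ℚ`, EVERY `u ∈ K ⊗_ℚ F`: THE CHARACTERISTIC POLYNOMIAL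
OF `ι_K(u)` ON THE BLOCK `V_𝔪 = ι_K(e_𝔪)(K ⊗ V)` IS `P(ū_𝔪· | F_𝔪)^d`**, `F_𝔪 = (K ⊗_ℚ F)/𝔪`, `d = dim_ℚ V/[F:ℚ]` (the block
`Vᵢ ≈ Lᵢ^{mᵢ}` with `mᵢ = m = d`).  Proof: with `u' = u e_𝔪`, «`α = ⊕ αᵢ`» gives `P(ι_K u') = P(ι_K(u)|V_𝔪) · ∏_{𝔫 ≠ 𝔪} X^{dim V_𝔫}`,
g57-#1 gives `P(ι_K u') = P(ū_𝔪·|F_𝔪)^d · ∏_{𝔫 ≠ 𝔪} X^{d·[F_𝔫:K]}`, and `dim V_𝔫 = d·[F_𝔫:K]` (g56-#13); cancel in `K[X]`.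
[cite: Milne1999LefschetzClasses, §2 Prop. 2.1 proof, p. 647 L27–L36, and p. 646 L43–L50] -/
theorem charpoly_restrict_baseChangeAction_eq_pow [Fintype (MaximalSpectrum (K ⊗[ℚ] F))]
    [DecidableEq (MaximalSpectrum (K ⊗[ℚ] F))] {e : MaximalSpectrum (K ⊗[ℚ] F) → K ⊗[ℚ] F}
    (he : ∀ I, IsIdempotentElem (e I) ∧ e I ∉ I.asIdeal ∧ ∀ J : MaximalSpectrum (K ⊗[ℚ] F), J ≠ I → e I ∈ J.asIdeal)
    (M : MaximalSpectrum (K ⊗[ℚ] F)) (u : K ⊗[ℚ] F)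
    (hu : ∀ x ∈ LinearMap.range (baseChangeAction K A.ι (e M)),
      baseChangeAction K A.ι u x ∈ LinearMap.range (baseChangeAction K A.ι (e M))) :
    ((baseChangeAction K A.ι u).restrict hu).charpoly =
      (Algebra.lmul K ((K ⊗[ℚ] F) ⧸ M.asIdeal) (Ideal.Quotient.mk M.asIdeal u)).charpoly ^
        (Module.finrank ℚ V / Module.finrank ℚ F) := by
  haveI := isReduced_baseChange_numberField K F
  have hortho := (completeOrthogonalIdempotents_primitiveIdempotents K he).toOrthogonalIdempotents
  obtain ⟨d, hd⟩ : ∃ d, d = Module.finrank ℚ V / Module.finrank ℚ F := ⟨_, rfl⟩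
  rw [← hd]
  have hmem := A.baseChangeAction_mem_centralizer_range K (u * e M)
  -- (a) the block decomposition of `ι_K(u e_M)`: `ι_K(u)|V_M` at `M`, zero on the other blocks
  have hA := A.charpoly_eq_prod_charpoly_restrict_of_mem_centralizer K he hmem
  have hbM : ((baseChangeAction K A.ι (u * e M)).restrict
      (A.apply_mem_range_baseChangeAction_of_mem_centralizer K hmem (e M))).charpoly =
      ((baseChangeAction K A.ι u).restrict hu).charpoly := by
    rw [A.restrict_baseChangeAction_mul_primitive_eq K (he M).1 u _ hu]
  have hbI : ∀ I, I ≠ M → ((baseChangeAction K A.ι (u * e M)).restrict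
      (A.apply_mem_range_baseChangeAction_of_mem_centralizer K hmem (e I))).charpoly =
      X ^ (d * Module.finrank K ((K ⊗[ℚ] F) ⧸ I.asIdeal)) := fun I hI => by
    rw [A.restrict_baseChangeAction_mul_primitive_eq_zero K (hortho.ortho (Ne.symm hI)) u,
      ← zero_smul K (1 : Module.End K (LinearMap.range (baseChangeAction K A.ι (e I)))), charpoly_smul_one_eq_pow,
      map_zero, sub_zero, A.finrank_range_baseChangeAction_eq_of_notMem K I (he I).2.1 (he I).2.2, hd]
  have hL : ∏ I, ((baseChangeAction K A.ι (u * e M)).restrict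
      (A.apply_mem_range_baseChangeAction_of_mem_centralizer K hmem (e I))).charpoly =
      ((baseChangeAction K A.ι u).restrict hu).charpoly *
        ∏ I ∈ Finset.univ.erase M, (X : K[X]) ^ (d * Module.finrank K ((K ⊗[ℚ] F) ⧸ I.asIdeal)) := by
    rw [← Finset.mul_prod_erase Finset.univ _ (Finset.mem_univ M), hbM]
    exact congrArg _ (Finset.prod_congr rfl fun I hI => hbI I (Finset.ne_of_mem_erase hI))
  -- (b) g57-#1 on `u e_M`: the residues are `ū_M` at `M` and `0` elsewhere
  have hB := A.charpoly_baseChangeAction_eq_prod_pow K (u * e M)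
  rw [← hd] at hB
  have hrM : (Algebra.lmul K ((K ⊗[ℚ] F) ⧸ M.asIdeal) (Ideal.Quotient.mk M.asIdeal (u * e M))).charpoly ^ d =
      (Algebra.lmul K ((K ⊗[ℚ] F) ⧸ M.asIdeal) (Ideal.Quotient.mk M.asIdeal u)).charpoly ^ d := by
    rw [map_mul, mk_eq_one_of_isIdempotentElem_of_notMem (K ⊗[ℚ] F) M (he M).1 (he M).2.1, mul_one]
  have hrI : ∀ I : MaximalSpectrum (K ⊗[ℚ] F), I ≠ M →
      (Algebra.lmul K ((K ⊗[ℚ] F) ⧸ I.asIdeal) (Ideal.Quotient.mk I.asIdeal (u * e M))).charpoly ^ d =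
      (X : K[X]) ^ (d * Module.finrank K ((K ⊗[ℚ] F) ⧸ I.asIdeal)) := fun I hI => by
    rw [Ideal.Quotient.eq_zero_iff_mem.2 (I.asIdeal.mul_mem_left u ((he M).2.2 I hI)), map_zero,
      ← zero_smul K (1 : Module.End K ((K ⊗[ℚ] F) ⧸ I.asIdeal)), charpoly_smul_one_eq_pow, map_zero, sub_zero, ← pow_mul,
      mul_comm]
  have hR : ∏ I : MaximalSpectrum (K ⊗[ℚ] F),
      (Algebra.lmul K ((K ⊗[ℚ] F) ⧸ I.asIdeal) (Ideal.Quotient.mk I.asIdeal (u * e M))).charpoly ^ d =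
      (Algebra.lmul K ((K ⊗[ℚ] F) ⧸ M.asIdeal) (Ideal.Quotient.mk M.asIdeal u)).charpoly ^ d *
        ∏ I ∈ Finset.univ.erase M, (X : K[X]) ^ (d * Module.finrank K ((K ⊗[ℚ] F) ⧸ I.asIdeal)) := by
    rw [← Finset.mul_prod_erase Finset.univ _ (Finset.mem_univ M), hrM]
    exact congrArg _ (Finset.prod_congr rfl fun I hI => hrI I (Finset.ne_of_mem_erase hI))
  -- cancel the common factor in `K[X]`
  rw [hA, hL, hR] at hB
  have hne : ∏ I ∈ Finset.univ.erase M, (X : K[X]) ^ (d * Module.finrank K ((K ⊗[ℚ] F) ⧸ I.asIdeal)) ≠ 0 :=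
    Finset.prod_ne_zero_iff.2 fun I _ => pow_ne_zero _ X_ne_zero
  exact mul_right_cancel₀ hne hB

set_option maxSynthPendingDepth 4 in
/-- **`tr(ι_K(u)|V_𝔪) = d · Tr_{F_𝔪/K}(ū_𝔪)`** for every `u ∈ K ⊗_ℚ F` and every field `K ⊇ ℚ` (the same comparison through
`u' = u e_𝔪`: «`α = ⊕ αᵢ`» gives `tr(ι_K u') = tr(ι_K(u)|V_𝔪)`, g57-#1 gives `tr(ι_K u') = d · Σ_𝔫 Tr_{F_𝔫/K}(ū'_𝔫) = d · Tr_{F_𝔪/K}(ū_𝔪)`).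
[cite: Milne1999LefschetzClasses, §2 Prop. 2.1 proof, p. 647 L27–L36, and p. 646 L43–L50] [cite: Shimura1998, §5.1 Proposition 2] -/
theorem trace_restrict_baseChangeAction_eq [Fintype (MaximalSpectrum (K ⊗[ℚ] F))]
    [DecidableEq (MaximalSpectrum (K ⊗[ℚ] F))] {e : MaximalSpectrum (K ⊗[ℚ] F) → K ⊗[ℚ] F}
    (he : ∀ I, IsIdempotentElem (e I) ∧ e I ∉ I.asIdeal ∧ ∀ J : MaximalSpectrum (K ⊗[ℚ] F), J ≠ I → e I ∈ J.asIdeal)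
    (M : MaximalSpectrum (K ⊗[ℚ] F)) (u : K ⊗[ℚ] F)
    (hu : ∀ x ∈ LinearMap.range (baseChangeAction K A.ι (e M)),
      baseChangeAction K A.ι u x ∈ LinearMap.range (baseChangeAction K A.ι (e M))) :
    LinearMap.trace K _ ((baseChangeAction K A.ι u).restrict hu) =
      (Module.finrank ℚ V / Module.finrank ℚ F : ℕ) *
        Algebra.trace K ((K ⊗[ℚ] F) ⧸ M.asIdeal) (Ideal.Quotient.mk M.asIdeal u) := by
  haveI := isReduced_baseChange_numberField K F
  have hortho := (completeOrthogonalIdempotents_primitiveIdempotents K he).toOrthogonalIdempotents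
  have hmem := A.baseChangeAction_mem_centralizer_range K (u * e M)
  have hA := A.trace_eq_sum_trace_restrict_of_mem_centralizer K he hmem
  have hbM : LinearMap.trace K _ ((baseChangeAction K A.ι (u * e M)).restrict
      (A.apply_mem_range_baseChangeAction_of_mem_centralizer K hmem (e M))) =
      LinearMap.trace K _ ((baseChangeAction K A.ι u).restrict hu) := by
    rw [A.restrict_baseChangeAction_mul_primitive_eq K (he M).1 u _ hu]
  have hbI : ∀ I, I ≠ M → LinearMap.trace K _ ((baseChangeAction K A.ι (u * e M)).restrict
      (A.apply_mem_range_baseChangeAction_of_mem_centralizer K hmem (e I))) = 0 := fun I hI => by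
    rw [A.restrict_baseChangeAction_mul_primitive_eq_zero K (hortho.ortho (Ne.symm hI)) u, map_zero]
  have hL : ∑ I, LinearMap.trace K _ ((baseChangeAction K A.ι (u * e M)).restrict
      (A.apply_mem_range_baseChangeAction_of_mem_centralizer K hmem (e I))) =
      LinearMap.trace K _ ((baseChangeAction K A.ι u).restrict hu) := by
    rw [Finset.sum_eq_single M (fun I _ hI => hbI I hI) (fun h => absurd (Finset.mem_univ M) h), hbM]
  have hB := A.trace_baseChangeAction_eq_mul_sum K (u * e M)
  have hrM : Algebra.trace K ((K ⊗[ℚ] F) ⧸ M.asIdeal) (Ideal.Quotient.mk M.asIdeal (u * e M)) =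
      Algebra.trace K ((K ⊗[ℚ] F) ⧸ M.asIdeal) (Ideal.Quotient.mk M.asIdeal u) := by
    rw [map_mul, mk_eq_one_of_isIdempotentElem_of_notMem (K ⊗[ℚ] F) M (he M).1 (he M).2.1, mul_one]
  have hrI : ∀ I : MaximalSpectrum (K ⊗[ℚ] F), I ≠ M →
      Algebra.trace K ((K ⊗[ℚ] F) ⧸ I.asIdeal) (Ideal.Quotient.mk I.asIdeal (u * e M)) = 0 := fun I hI => by
    rw [Ideal.Quotient.eq_zero_iff_mem.2 (I.asIdeal.mul_mem_left u ((he M).2.2 I hI)), map_zero]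
  have hR : ∑ I : MaximalSpectrum (K ⊗[ℚ] F), Algebra.trace K ((K ⊗[ℚ] F) ⧸ I.asIdeal) (Ideal.Quotient.mk I.asIdeal (u * e M)) =
      Algebra.trace K ((K ⊗[ℚ] F) ⧸ M.asIdeal) (Ideal.Quotient.mk M.asIdeal u) := by
    rw [Finset.sum_eq_single M (fun I _ hI => hrI I hI) (fun h => absurd (Finset.mem_univ M) h), hrM]
  rw [hA, hL, hR] at hB
  exact hB

set_option maxSynthPendingDepth 4 in
/-- **`det_K(ι_K(u) | V_𝔪) = N_{F_𝔪/K}(ū_𝔪)^d`**, `d = dim_ℚ V/[F:ℚ]`, for the primitive idempotents `e_𝔪` and every `u ∈ K ⊗_ℚ F`: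
the constant term of `P(ι_K(u)|V_𝔪) = P(ū_𝔪·|F_𝔪)^d` (`charpoly_restrict_baseChangeAction_eq_pow`), with `dim_K V_𝔪 = d·[F_𝔪:K]`
(g56-#13) and `N_{F_𝔪/K}(ū) = (-1)^{[F_𝔪:K]} P(ū·)(0)` — the determinant reading of «`αᵢ : Vᵢ → Vᵢ`, `Fᵢ`-linear» for
`α = ι_K(u)`, alongside «`P_α(X) = ∏ (P_{Fᵢ/k, αᵢ}(X))^m`». [cite: Milne1999LefschetzClasses, §2 p. 646 L43–L50 and Prop. 2.1
proof p. 647 L27–L36] -/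
theorem det_restrict_baseChangeAction_eq_pow [Fintype (MaximalSpectrum (K ⊗[ℚ] F))]
    [DecidableEq (MaximalSpectrum (K ⊗[ℚ] F))] {e : MaximalSpectrum (K ⊗[ℚ] F) → K ⊗[ℚ] F}
    (he : ∀ I, IsIdempotentElem (e I) ∧ e I ∉ I.asIdeal ∧ ∀ J : MaximalSpectrum (K ⊗[ℚ] F), J ≠ I → e I ∈ J.asIdeal)
    (M : MaximalSpectrum (K ⊗[ℚ] F)) (u : K ⊗[ℚ] F)
    (hu : ∀ x ∈ LinearMap.range (baseChangeAction K A.ι (e M)),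
      baseChangeAction K A.ι u x ∈ LinearMap.range (baseChangeAction K A.ι (e M))) :
    LinearMap.det ((baseChangeAction K A.ι u).restrict hu) =
      Algebra.norm K (Ideal.Quotient.mk M.asIdeal u) ^ (Module.finrank ℚ V / Module.finrank ℚ F) := by
  haveI := isReduced_baseChange_numberField K F
  rw [LinearMap.det_eq_sign_charpoly_coeff, A.charpoly_restrict_baseChangeAction_eq_pow K he M u hu,
    Polynomial.coeff_zero_eq_eval_zero, Polynomial.eval_pow, ← Polynomial.coeff_zero_eq_eval_zero,
    A.finrank_range_baseChangeAction_eq_of_notMem K M (he M).2.1 (he M).2.2, Algebra.norm_apply,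
    LinearMap.det_eq_sign_charpoly_coeff, mul_pow, ← pow_mul,
    Nat.mul_comm (Module.finrank K ((K ⊗[ℚ] F) ⧸ M.asIdeal)) (Module.finrank ℚ V / Module.finrank ℚ F)]

set_option maxSynthPendingDepth 4 in
/-- **`det_K(ι_K(u) | V_𝔪) ≠ 0 ⟺ u ∉ 𝔪`** (`V ≠ 0`, so `d ≥ 1`): `N_{F_𝔪/K}(ū_𝔪)^d ≠ 0 ⟺ ū_𝔪 ≠ 0` in the field `F_𝔪`.
[cite: Milne1999LefschetzClasses, §2 p. 646 L43–L50 and Prop. 2.1 p. 647 L14–L16] -/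
theorem det_restrict_baseChangeAction_ne_zero_iff [Nontrivial V] [Fintype (MaximalSpectrum (K ⊗[ℚ] F))]
    [DecidableEq (MaximalSpectrum (K ⊗[ℚ] F))] {e : MaximalSpectrum (K ⊗[ℚ] F) → K ⊗[ℚ] F}
    (he : ∀ I, IsIdempotentElem (e I) ∧ e I ∉ I.asIdeal ∧ ∀ J : MaximalSpectrum (K ⊗[ℚ] F), J ≠ I → e I ∈ J.asIdeal)
    (M : MaximalSpectrum (K ⊗[ℚ] F)) (u : K ⊗[ℚ] F)
    (hu : ∀ x ∈ LinearMap.range (baseChangeAction K A.ι (e M)),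
      baseChangeAction K A.ι u x ∈ LinearMap.range (baseChangeAction K A.ι (e M))) :
    LinearMap.det ((baseChangeAction K A.ι u).restrict hu) ≠ 0 ↔ u ∉ M.asIdeal := by
  haveI : Module.Finite K ((K ⊗[ℚ] F) ⧸ M.asIdeal) :=
    Module.Finite.of_surjective (Ideal.Quotient.mkₐ K M.asIdeal).toLinearMap (Ideal.Quotient.mkₐ_surjective K _)
  have hd : Module.finrank ℚ V / Module.finrank ℚ F ≠ 0 :=
    (Nat.div_pos (Nat.le_of_dvd Module.finrank_pos A.finrank_field_dvd_finrank) Module.finrank_pos).ne'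
  rw [A.det_restrict_baseChangeAction_eq_pow K he M u hu, Ne, pow_eq_zero_iff hd, Algebra.norm_eq_zero_iff,
    Ideal.Quotient.eq_zero_iff_mem]

set_option maxSynthPendingDepth 4 in
/-- **`ι_K(u) | V_𝔪` IS INVERTIBLE `⟺ u ∉ 𝔪`** (`V ≠ 0`): the block `αᵢ` of `α = ι_K(u)` on `Vᵢ` is the `Fᵢ`-scalar `ūᵢ`, invertible
exactly when `ūᵢ ≠ 0` (`det = N_{F_𝔪/K}(ū_𝔪)^d`). [cite: Milne1999LefschetzClasses, §2 p. 646 L43–L50 and Prop. 2.1 p. 647 L14–L16] -/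
theorem isUnit_restrict_baseChangeAction_iff [Nontrivial V] [Fintype (MaximalSpectrum (K ⊗[ℚ] F))]
    [DecidableEq (MaximalSpectrum (K ⊗[ℚ] F))] {e : MaximalSpectrum (K ⊗[ℚ] F) → K ⊗[ℚ] F}
    (he : ∀ I, IsIdempotentElem (e I) ∧ e I ∉ I.asIdeal ∧ ∀ J : MaximalSpectrum (K ⊗[ℚ] F), J ≠ I → e I ∈ J.asIdeal)
    (M : MaximalSpectrum (K ⊗[ℚ] F)) (u : K ⊗[ℚ] F)
    (hu : ∀ x ∈ LinearMap.range (baseChangeAction K A.ι (e M)),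
      baseChangeAction K A.ι u x ∈ LinearMap.range (baseChangeAction K A.ι (e M))) :
    IsUnit ((baseChangeAction K A.ι u).restrict hu) ↔ u ∉ M.asIdeal := by
  rw [LinearMap.isUnit_iff_isUnit_det, isUnit_iff_ne_zero, A.det_restrict_baseChangeAction_ne_zero_iff K he M u hu]

end EndAction

end HodgeStructure

end Literature.AlgebraicGeometry.Motives
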